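import Literature.NumberTheory.GelbartRogawski1991.LocalRankTwoGaloisConjSimilitudeModels
import Literature.NumberTheory.GelbartRogawski1991.LocalSplittingCMGaloisTransportUndoubled
import Literature.NumberTheory.GelbartRogawski1991.LocalDoubledUnitaryDeltaTransport
import Literature.NumberTheory.GaloisRepresentations.HeckeCharacterGaloisConjLocalComponent
import Literature.NumberTheory.Automorphic.Liu2021.LemD1RankTwoCMLetters
import HarnessLib

/-
Copyright (c) 2026 the pub-hodgecm-mathlib formalisation cell (harness21).  Prover seat hodgecm-mathlib-A-p18 (g24), floor 0, programme P5 (Alb-CM),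
ROAD CARD v4 piece (C4bΘ).  KERNEL module: THEOREMS ONLY (no definition, no named fact, no `sorry`, no instance, no notation).
-/

/-!
# F0 · P5 pay-down line (ED. 7), letter L4if `stub_letter_lemD14_if_nonsplit`, ROAD CARD v4 piece (C4bΘ): ★ (C4b)
# `exists_coinv_equiv_galConj_similitude_models` READ IN THE Θ-CURRENCY of [Liu2021, Lem. D.1]'s indexed family at a non-split place

Cell `hodgecm-mathlib`, floor 0, programme P5; crux item `stmt-HodgeConjecture-24832` (`…Theses.HCCMUnconditional.HLiu418`).  Link (iv), sections' half, of
ROAD CARD v4 §2 (`F0/P5/A-p18/g24/ROAD-L4if-v4.A-p18g24.md`) for ★ `LemD1RankTwoCMLetters.LemD1_4IfAsPrintedNonsplitCM₂`.  `L` CM, `F = L⁺`, `c`,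
`δ = imagUnit L`, real non-zero frame `dV : Fin 2 → L` (`T_V = realDiagonal dV`, `J_V = diagonal dV`), ANY reindexing `e : Fin 2 × Fin 1 ≃ Fin 2`,
conjugate-symplectic `λ` (`Λ`, `Λᶜ = toHeckeCharacter (galConj c λ)`, splitting by ★ `IsConjugateSymplectic.galConj`), a centre character `χ` of
`L¹(𝔸_{F,f})`, lines `a₀, a` with `T_a = (det T_{a₀})⁻¹ • T_{a₀}` (`T_b := gram e T_V (b)`; hypothesis `ha`), a place `v` NON-SPLIT in `L` (`hns`).
* §1 (generic `TwistedCoinv`): `exists_equiv_of_comp_centre` — retyping the centre along a SURJECTIVE `φ : H′ →* H` with `ι′ = ι ∘ φ`, `χ′ = χ ∘ φ`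
  (EQUAL relation submodules); `exists_equiv_of_eq`; `exists_equiv_trans`.
* §2: the rank-one retyping ★ `scaleInl` between the centres of two lines carries `localCenter` (`localCenter_scaleInl_one`) and the centre
  characters (`localCharOfCenter_scaleInl_one`: both are `χ` at ONE finite-adelic point, ★ `localCharOfCenter_eq_comp_inclPlace`, `glRegroup`,
  `evalAt_inclPlace_*`, `coe_scaleInl`) (the letter's package at `v` IS `ω^{T_b} ∘ localSplittingCM` by ★ `congrW_undoubledSplittings_cmFinLocalFamily_s`,
  and `localSplittingCM = localSplittingCMWith … addHaar` is `rfl` under `borel`).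
* §3 **`exists_coinv_equiv_galConj_similitude_theta`**: ★ (C4b) (A-p18 (g23), p838770) at `T₀ := T_{a₀}` (diagonal, ★ `gram_TW_eq_diagonal`),
  `T₀′ := T_{−a₀}` (★ `gram_TW_eq_smul`), `T₀″ := T_a` (`ha`), `J₁ := JW(−a₀)`, `ξ := ξ_{−a₀}`, Borel Haar data; mover of `ℓ_Δ` onto `ℓ_Y` by the ★
  `LocalLineIsometryNaturality` recipe (`deltaD`, ★ `map_transportSp_deltaDiag_deltaLagrangian`, ★ `existsImplementer_localSchrodinger`);
  `(Λᶜ_w)⁻¹ = (Λ_w)⁻¹ ∘ σ_w` by ★ `localComponent_toHeckeCharacter_galConj_inv_eq_comp_of_smul_eq`; pulled back to `U(V)(F_v)` along `k ↦ k ⊗ 1` (★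
  `scaleInl_localLineInl`), read on ANY packages `𝓣′`, `𝓣` whose sections at `v` ARE the CM sections (`h𝓣′`, `h𝓣`), the `Λ`-side centre retyped to its
  own line `a`, assembled by ★ `exists_conj_twisted_intertwiner`: **`∃ E : Coinv(ω′_v ∘ Z_{−a₀}, ξ_{−a₀}∘bar₁) ≃ₗ[ℂ] Coinv(ω_v ∘ Z_a, ξ_a)`,
  `E ∘ Θ′(k ⊗ 1) = ξ_{−a₀}((det(k ⊗ 1))⁻¹·1) • Θ(k ⊗ 1) ∘ E`** (`rep … ∘ localLineInl` currency of ★ `areIsomorphicRep_localType₂_iff_quot`).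
Heartbeats: statement/instantiation-dominated (★ (C4b) itself carries 4 M); measured: fails at 4 M, passes at 8 M (≈ 480 s); budget 12 M.  Lesson: NO `rw`
on the instantiated (C4b) identity (`whnf` blow-up > 16 M) — group elements move by `congrArg` on small lambdas.
HONEST LABEL: HC_CM is proved only modulo the printed citations — the 2 remaining named inputs (hLiu418, h413) — until rung 0 closes; this file proves
helper lemmas toward ONE registered letter stub (L4if) of ONE floor-0 pay-down line and discharges no letter by itself.

## References
* [Liu2021] Y. Liu, Camb. J. Math. 9 (2021) = arXiv:2102.11518, App. D §D.1 Steps 1–3 (l. 5213–5224), Lem. D.1 (4) (p. 126, l. 5235), proof l. 5255–5262.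
* [GelbartRogawski1991] S. Gelbart, J. Rogawski, Invent. Math. 105 (1991), §3.1 p. 454, Prop. 3.1.1 p. 455 L1–3, Remark p. 457 L4–13.
* [MoeglinVignerasWaldspurger1987] C. Mœglin, M.-F. Vignéras, J.-L. Waldspurger, LNM 1291 (1987), Chap. 2 II.1–II.2, Chap. 3 I.1.
* [Mok2014] C. P. Mok, Mem. AMS 235 (2015), §1 Notation p. 5.  [TateThesis1967] J. Tate, in Cassels–Fröhlich (1967), §3.2 Lemma 3.2.1.
-/

set_option autoImplicit false
set_option Elab.async false
set_option linter.dupNamespace false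

noncomputable section

open scoped Matrix Kronecker
open NumberField IsDedekindDomain MeasureTheory Matrix
open Literature.RepresentationTheory.HeisenbergGroup Literature.RepresentationTheory.HeisenbergGroup.SymplecticMatrix
open Literature.NumberTheory.Automorphic Literature.NumberTheory.Automorphic.UnitaryGroup Literature.NumberTheory.Weil1964
open Literature.NumberTheory.GaloisRepresentations Literature.RepresentationTheory.HarrisKudlaSweet1996
open Literature.RepresentationTheory Literature.RepresentationTheory.TwistedCoinv
open Literature.NumberTheory.GelbartRogawski1991 Literature.NumberTheory.GelbartRogawski1991.UnitaryDualPair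
open Literature.NumberTheory.GelbartRogawski1991.UnitaryDualPair.LocalSplitting
open Literature.NumberTheory.GelbartRogawski1991.UnitaryDualPair.WeilCoinv
open Literature.NumberTheory.GelbartRogawski1991.GRConstruction
open Literature.RepresentationTheory.Liu2021
open Literature.NumberTheory.Automorphic.IdeleClassGroup
open Literature.NumberTheory.Automorphic.Liu2021 Literature.NumberTheory.Automorphic.Liu2021.Def411WeilCarriers
open Literature.NumberTheory.Automorphic.Liu2021.Def411WeilCarriersDoubling

/-! ## §1 Generic: retyping the centre along a surjection `φ : H′ →* H` with `ι′ = ι ∘ φ`, `χ′ = χ ∘ φ` -/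

namespace Summit.HodgeConjecture.HodgeConjecture.Cruxes.HLiu418.F0P5LemD14IfGaloisSimilitudeTheta

variable {k : Type*} [CommRing k] {G H H' S : Type*} [Group G] [Group H] [Group H'] [AddCommGroup S] [Module k S]

/-- **Retyping the centre.**  For `ρ : G → GL(S)`, two centre embeddings `ι : H →* G`, `ι′ : H′ →* G` with `ι′ = ι ∘ φ` for a SURJECTIVE `φ : H′ →* H`, and
characters `χ′ = χ ∘ φ`: the relation submodules of the `χ`-coinvariants of `ρ ∘ ι` and of the `χ′`-coinvariants of `ρ ∘ ι′` are EQUAL, so the identity on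
classes is an isomorphism `(ρ ∘ ι′)_{χ′} ≃ (ρ ∘ ι)_χ` intertwining `rep χ′ ρ` with `rep χ ρ`. [cite: MoeglinVignerasWaldspurger1987, Chap. 2 II.2] -/
theorem exists_equiv_of_comp_centre (ρ : Representation k G S) (ι : H →* G) (ι' : H' →* G) (φ : H' →* H) (hφ : Function.Surjective φ)
    (hι : ∀ h', ι' h' = ι (φ h')) (χ : H →* kˣ) (χ' : H' →* kˣ) (hχ : ∀ h', χ' h' = χ (φ h'))
    (hc : ∀ (g : G) (h : H), Commute (ρ g) ((ρ.comp ι) h)) (hc' : ∀ (g : G) (h' : H'), Commute (ρ g) ((ρ.comp ι') h')) :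
    ∃ e : Coinv (ρ.comp ι') χ' ≃ₗ[k] Coinv (ρ.comp ι) χ, ∀ (g : G) (x : Coinv (ρ.comp ι') χ'), e (rep χ' ρ hc' g x) = rep χ ρ hc g (e x) := by
  have hW : TwistedCoinv.ker (ρ.comp ι') χ' = TwistedCoinv.ker (ρ.comp ι) χ := by
    apply le_antisymm
    · rw [TwistedCoinv.ker, Submodule.span_le]
      rintro _ ⟨⟨h', w⟩, rfl⟩
      have h1 : (ρ.comp ι') h' w - ((χ' h' : kˣ) : k) • w = (ρ.comp ι) (φ h') w - ((χ (φ h') : kˣ) : k) • w := by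
        rw [MonoidHom.comp_apply, MonoidHom.comp_apply, hι, hχ]
      show (ρ.comp ι') h' w - ((χ' h' : kˣ) : k) • w ∈ TwistedCoinv.ker (ρ.comp ι) χ
      rw [h1]
      exact TwistedCoinv.sub_mem_ker _ _ _ _
    · rw [TwistedCoinv.ker, Submodule.span_le]
      rintro _ ⟨⟨h, w⟩, rfl⟩
      obtain ⟨h', rfl⟩ := hφ h
      have h1 : (ρ.comp ι) (φ h') w - ((χ (φ h') : kˣ) : k) • w = (ρ.comp ι') h' w - ((χ' h' : kˣ) : k) • w := by
        rw [MonoidHom.comp_apply, MonoidHom.comp_apply, hι, hχ]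
      show (ρ.comp ι) (φ h') w - ((χ (φ h') : kˣ) : k) • w ∈ TwistedCoinv.ker (ρ.comp ι') χ'
      rw [h1]
      exact TwistedCoinv.sub_mem_ker _ _ _ _
  refine ⟨Submodule.quotEquivOfEq _ _ hW, fun g x => ?_⟩
  obtain ⟨w, rfl⟩ := TwistedCoinv.mk_surjective _ _ x
  rw [TwistedCoinv.rep_mk, TwistedCoinv.mk_apply, TwistedCoinv.mk_apply, Submodule.quotEquivOfEq_mk, Submodule.quotEquivOfEq_mk]
  rfl

/-- **Equal pair representations have canonically isomorphic coinvariants** (the identity on classes), equivariantly for `rep`.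
[cite: MoeglinVignerasWaldspurger1987, Chap. 2 II.2] -/
theorem exists_equiv_of_eq (ρ₁ ρ₂ : Representation k G S) (h : ρ₂ = ρ₁) (ι : H →* G) (χ : H →* kˣ)
    (hc₁ : ∀ (g : G) (h : H), Commute (ρ₁ g) ((ρ₁.comp ι) h)) (hc₂ : ∀ (g : G) (h : H), Commute (ρ₂ g) ((ρ₂.comp ι) h)) :
    ∃ e : Coinv (ρ₂.comp ι) χ ≃ₗ[k] Coinv (ρ₁.comp ι) χ, ∀ (g : G) (x : Coinv (ρ₂.comp ι) χ), e (rep χ ρ₂ hc₂ g x) = rep χ ρ₁ hc₁ g (e x) := by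
  subst h
  exact ⟨LinearEquiv.refl k _, fun _ _ => rfl⟩

/-- composition of two equivariant identifications (bookkeeping). [cite: MoeglinVignerasWaldspurger1987, Chap. 2 II.2] -/
theorem exists_equiv_trans {G₀ A B C : Type*} [AddCommGroup A] [Module k A] [AddCommGroup B] [Module k B] [AddCommGroup C] [Module k C]
    (rA : G₀ → A →ₗ[k] A) (rB : G₀ → B →ₗ[k] B) (rC : G₀ → C →ₗ[k] C)
    (h₁ : ∃ e₁ : A ≃ₗ[k] B, ∀ (g : G₀) (x : A), e₁ (rA g x) = rB g (e₁ x))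
    (h₂ : ∃ e₂ : B ≃ₗ[k] C, ∀ (g : G₀) (y : B), e₂ (rB g y) = rC g (e₂ y)) :
    ∃ e : A ≃ₗ[k] C, ∀ (g : G₀) (x : A), e (rA g x) = rC g (e x) := by
  obtain ⟨e₁, he₁⟩ := h₁
  obtain ⟨e₂, he₂⟩ := h₂
  exact ⟨e₁.trans e₂, fun g x => by rw [LinearEquiv.trans_apply, LinearEquiv.trans_apply, he₁, he₂]⟩

/-! ## §2 Unitary bookkeeping on the lines: `scaleInl₁` between the centres of two lines, and the centre characters -/

section Lines

variable (F E : Type) [Field F] [NumberField F] [Field E] [NumberField E] [Algebra F E] [Algebra.IsQuadraticExtension F E] (c : E ≃ₐ[F] E)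
  (N : ℕ) {n : ℕ} (e : Fin N × Fin 1 ≃ Fin n) (JV : Matrix (Fin N) (Fin N) E) (b₁ b₂ : Fˣ) (v : HeightOneSpectrum (𝓞 F))

omit [NumberField F] in
/-- `TW b₂ = (b₂ b₁⁻¹) • TW b₁`. [cite: Liu2021, App. D §D.1 Step 1 (l. 5217)] -/
theorem TW_eq_smul_TW : TW F b₂ = ((b₂ * b₁⁻¹ : Fˣ) : F) • TW F b₁ := by
  ext i j
  fin_cases i; fin_cases j
  simp [TW, Units.val_mul]

omit [Algebra.IsQuadraticExtension F E] in
/-- the retyping `U(J_{W,b₁})(F_v) →* U(J_{W,b₂})(F_v)` of the rank-one centres (★ `scaleInl` at `N = 1`) carries `localCenter … (JW b₁)` to `localCenter … (JW b₂)`.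
[cite: Mok2014, §1 Notation p. 5] -/
theorem localCenter_scaleInl_one (J : Matrix (Fin n) (Fin n) E) (z : localPi E c 1 (JW F E b₁) v) :
    localCenter E c n J (JW F E b₂) (JW_apply_ne_zero F E b₂) v
        (scaleInl F E c 1 (TW F b₁) (TW F b₂) (b₂ * b₁⁻¹) (TW_eq_smul_TW F b₁ b₂) (JW_eq F E b₁) (JW_eq F E b₂) v z) =
      localCenter E c n J (JW F E b₁) (JW_apply_ne_zero F E b₁) v z :=
  Subtype.ext (by rw [coe_localCenter, coe_localCenter, coe_scaleInl])

omit [Algebra.IsQuadraticExtension F E] in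
/-- the centre characters of two lines agree along the retyping: `ξ_{b₂} (scaleInl₁ z) = ξ_{b₁} z` (both are `χ` at ONE adelic point).
[cite: Liu2021, App. D §D.1 Step 3 (l. 5221)] -/
theorem localCharOfCenter_scaleInl_one (χ : finAdelicOne F E c →* ℂˣ) (z : localPi E c 1 (JW F E b₁) v) :
    localCharOfCenter F E c (JW F E b₂) (JW_apply_ne_zero F E b₂) χ v
        (scaleInl F E c 1 (TW F b₁) (TW F b₂) (b₂ * b₁⁻¹) (TW_eq_smul_TW F b₁ b₂) (JW_eq F E b₁) (JW_eq F E b₂) v z) =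
      localCharOfCenter F E c (JW F E b₁) (JW_apply_ne_zero F E b₁) χ v z := by
  rw [localCharOfCenter_eq_comp_inclPlace, localCharOfCenter_eq_comp_inclPlace, MonoidHom.comp_apply, MonoidHom.comp_apply,
    MonoidHom.comp_apply, MonoidHom.comp_apply]
  -- the two finite-adelic points have the same underlying matrix («`z` at the places over `v`, `1` elsewhere»)
  have hmat : ((inclPlace F E c 1 (JW F E b₂) v
        (scaleInl F E c 1 (TW F b₁) (TW F b₂) (b₂ * b₁⁻¹) (TW_eq_smul_TW F b₁ b₂) (JW_eq F E b₁) (JW_eq F E b₂) v z) : finAdelic F E c 1 (JW F E b₂)) :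
        GL (Fin 1) (FiniteAdeleRing (𝓞 E) E)) =
      ((inclPlace F E c 1 (JW F E b₁) v z : finAdelic F E c 1 (JW F E b₁)) : GL (Fin 1) (FiniteAdeleRing (𝓞 E) E)) := by
    apply (glRegroup F E 1).injective
    refine DFunLike.ext _ _ fun v' => funext fun w => ?_
    rw [glRegroup_apply_apply, glRegroup_apply_apply]
    by_cases hv : v' = v
    · subst hv
      rw [evalAt_inclPlace_of_over, evalAt_inclPlace_of_over, coe_scaleInl]
    · rw [evalAt_inclPlace_of_not_over F E c 1 (JW F E b₂) hv, evalAt_inclPlace_of_not_over F E c 1 (JW F E b₁) hv]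
  have key : finAdelicCenterInv F E c (JW F E b₂) (JW_apply_ne_zero F E b₂) (inclPlace F E c 1 (JW F E b₂) v
        (scaleInl F E c 1 (TW F b₁) (TW F b₂) (b₂ * b₁⁻¹) (TW_eq_smul_TW F b₁ b₂) (JW_eq F E b₁) (JW_eq F E b₂) v z)) =
      finAdelicCenterInv F E c (JW F E b₁) (JW_apply_ne_zero F E b₁) (inclPlace F E c 1 (JW F E b₁) v z) := by
    refine Subtype.ext ?_
    rw [coe_finAdelicCenterInv, coe_finAdelicCenterInv, hmat]
  rw [key]

omit [Algebra.IsQuadraticExtension F E] in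
/-- `scaleInl₁` is surjective (a bijective retyping). [cite: GelbartRogawski1991, §3.1 p. 454] -/
theorem scaleInl_one_surjective :
    Function.Surjective (scaleInl F E c 1 (TW F b₁) (TW F b₂) (b₂ * b₁⁻¹) (TW_eq_smul_TW F b₁ b₂) (JW_eq F E b₁) (JW_eq F E b₂) v) :=
  fun z => ⟨scaleInv F E c 1 (TW F b₁) (TW F b₂) (b₂ * b₁⁻¹) (TW_eq_smul_TW F b₁ b₂) (JW_eq F E b₁) (JW_eq F E b₂) v z, scaleInl_scaleInv ..⟩

end Lines

/-! ## §3 (C4bΘ) at the CM packages -/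

section CM

variable (L : Type) [Field L] [NumberField L] [IsCMField L]
  (dV : Fin 2 → L) (hdV : ∀ i, IsCMField.complexConj L (dV i) = dV i) (hdV0 : ∀ i, dV i ≠ 0) (e : Fin 2 × Fin 1 ≃ Fin 2)
  (lam : Literature.NumberTheory.Automorphic.IdeleClassGroup L →ₜ* Circle) (hlam : IsConjugateSymplectic L lam)
  (χ : finAdelicOne (Fp L) L (IsCMField.complexConj L) →* ℂˣ)
  (a₀ a : (Fp L)ˣ) (v : HeightOneSpectrum (𝓞 (Fp L)))

set_option synthInstance.maxHeartbeats 400000 in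
set_option maxHeartbeats 12000000 in -- measured: fails at 4 M (★ (C4b)'s own budget), passes at 8 M (≈ 480 s); 12 M = 1.5× head-room
/-- **(C4bΘ)** — ★ (C4b) `exists_coinv_equiv_galConj_similitude_models` at `T₀ := gram e T_V (a₀)`, `T₀′ := gram e T_V (−a₀)`, `T₀″ := gram e T_V (a)` (`ha`),
`J₁ := JW (−a₀)`, Borel Haar data, for the CM sections of `Λᶜ` (line `−a₀`) and `Λ` (line `a`) and `ξ_{−a₀} = χ_v`, PULLED BACK to `U(V)(F_v)` along `k ↦ k ⊗ 1`
and read on ANY two splitting packages `𝓣′`, `𝓣` whose sections at `v` ARE those CM sections (`h𝓣′`, `h𝓣`; for the letter's packages ★ `congrW_undoubledSplittings_cmFinLocalFamily_s`),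
the centre of the `Λ` side retyped to its own line `a`: **`Θ_{ξ_{−a₀}∘bar₁}(Λᶜ, −a₀) ≅ (ξ_{−a₀} ∘ det⁻¹) ⊗ Θ_{ξ_a}(Λ, a)`** as representations of `U(V)(F_v)`.
[cite: Liu2021, App. D Lemma D.1 (4) (l. 5235), §D.1 Step 3 (l. 5221)] [cite: GelbartRogawski1991, §3.1 Remark p. 457 L4–13] [cite: MoeglinVignerasWaldspurger1987, Chap. 2 II.1–II.2] -/
theorem exists_coinv_equiv_galConj_similitude_theta
    (hns : ∀ w : PlacesOver L v, IsCMField.complexConj L • w.1 = w.1)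
    (hTd : (gram (Fp L) e (realDiagonal L dV hdV) (TW (Fp L) a₀)).det ≠ 0)
    (ha : gram (Fp L) e (realDiagonal L dV hdV) (TW (Fp L) a) =
      (((Units.mk0 _ hTd)⁻¹ : (Fp L)ˣ) : Fp L) • gram (Fp L) e (realDiagonal L dV hdV) (TW (Fp L) a₀))
    (𝓣' : FinLocalSplittings (Fp L) L (IsCMField.complexConj L) 2 (complexConj_imagUnit L) (imagUnit_ne_zero L) (imagUnit_mul_self L)
      (gram (Fp L) e (realDiagonal L dV hdV) (TW (Fp L) (-a₀))) (isSymm_gram (Fp L) e (realDiagonal_isSymm L dV hdV) (isSymm_TW (Fp L) (-a₀)))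
      (reindex_kronecker_eq_gram_map (Fp L) L e (realDiagonal_map L dV hdV).symm (JW_eq (Fp L) L (-a₀))))
    (h𝓣' : 𝓣'.s v = localSplittingCM L 2 (isSymm_gram (Fp L) e (realDiagonal_isSymm L dV hdV) (isSymm_TW (Fp L) (-a₀)))
      (isUnit_det_gram (Fp L) e (isUnit_det_realDiagonal L dV hdV hdV0) (isUnit_det_TW (Fp L) (-a₀)))
      (reindex_kronecker_eq_gram_map (Fp L) L e (realDiagonal_map L dV hdV).symm (JW_eq (Fp L) L (-a₀)))
      (toHeckeCharacter L (IdeleClassGroup.galConj (IsCMField.complexConj L) lam))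
      ((isOscillatorChar_toHeckeCharacter_iff _).mpr hlam.galConj) v)
    (𝓣 : FinLocalSplittings (Fp L) L (IsCMField.complexConj L) 2 (complexConj_imagUnit L) (imagUnit_ne_zero L) (imagUnit_mul_self L)
      (gram (Fp L) e (realDiagonal L dV hdV) (TW (Fp L) a)) (isSymm_gram (Fp L) e (realDiagonal_isSymm L dV hdV) (isSymm_TW (Fp L) a))
      (reindex_kronecker_eq_gram_map (Fp L) L e (realDiagonal_map L dV hdV).symm (JW_eq (Fp L) L a)))
    (h𝓣 : 𝓣.s v = localSplittingCM L 2 (isSymm_gram (Fp L) e (realDiagonal_isSymm L dV hdV) (isSymm_TW (Fp L) a))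
      (isUnit_det_gram (Fp L) e (isUnit_det_realDiagonal L dV hdV hdV0) (isUnit_det_TW (Fp L) a))
      (reindex_kronecker_eq_gram_map (Fp L) L e (realDiagonal_map L dV hdV).symm (JW_eq (Fp L) L a))
      (toHeckeCharacter L lam) ((isOscillatorChar_toHeckeCharacter_iff _).mpr hlam) v) :
    ∃ E : Coinv ((𝓣'.omegaLoc v).comp (localCenter L (IsCMField.complexConj L) 2 (Matrix.reindex e e (Matrix.diagonal dV ⊗ₖ JW (Fp L) L (-a₀)))
            (JW (Fp L) L (-a₀)) (JW_apply_ne_zero (Fp L) L (-a₀)) v))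
          ((localCharOfCenter (Fp L) L (IsCMField.complexConj L) (JW (Fp L) L (-a₀)) (JW_apply_ne_zero (Fp L) L (-a₀)) χ v).comp
            (localPiGalConj L (IsCMField.complexConj L) 1 v (JW_eq (Fp L) L (-a₀)))) ≃ₗ[ℂ]
        Coinv ((𝓣.omegaLoc v).comp (localCenter L (IsCMField.complexConj L) 2 (Matrix.reindex e e (Matrix.diagonal dV ⊗ₖ JW (Fp L) L a))
            (JW (Fp L) L a) (JW_apply_ne_zero (Fp L) L a) v))
          (localCharOfCenter (Fp L) L (IsCMField.complexConj L) (JW (Fp L) L a) (JW_apply_ne_zero (Fp L) L a) χ v),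
      ∀ (k : localPi L (IsCMField.complexConj L) 2 (Matrix.diagonal dV) v) x,
        E (rep ((localCharOfCenter (Fp L) L (IsCMField.complexConj L) (JW (Fp L) L (-a₀)) (JW_apply_ne_zero (Fp L) L (-a₀)) χ v).comp
              (localPiGalConj L (IsCMField.complexConj L) 1 v (JW_eq (Fp L) L (-a₀))))
            (𝓣'.omegaLoc v)
            (commute_comp_localCenter' (JW_apply_ne_zero (Fp L) L (-a₀)) (𝓣'.omegaLoc v))
            (localLineInl L (IsCMField.complexConj L) 2 e (Matrix.diagonal dV) (JW (Fp L) L (-a₀)) v k) x) =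
          ((localCharOfCenter (Fp L) L (IsCMField.complexConj L) (JW (Fp L) L (-a₀)) (JW_apply_ne_zero (Fp L) L (-a₀)) χ v
              (localUnitScalar L (IsCMField.complexConj L) (JW (Fp L) L (-a₀)) v _
                (inv_det_mul_conjLocal_inv_det L (IsCMField.complexConj L)
                  (reindex_kronecker_eq_gram_map (Fp L) L e (realDiagonal_map L dV hdV).symm (JW_eq (Fp L) L a₀)) v
                  (complexConj_imagUnit L) (imagUnit_ne_zero L) hTd
                  (localLineInl L (IsCMField.complexConj L) 2 e (Matrix.diagonal dV) (JW (Fp L) L a₀) v k))) : ℂˣ) : ℂ) •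
            rep (localCharOfCenter (Fp L) L (IsCMField.complexConj L) (JW (Fp L) L a) (JW_apply_ne_zero (Fp L) L a) χ v) (𝓣.omegaLoc v)
              (commute_comp_localCenter' (JW_apply_ne_zero (Fp L) L a) (𝓣.omegaLoc v))
              (localLineInl L (IsCMField.complexConj L) 2 e (Matrix.diagonal dV) (JW (Fp L) L a) v k) (E x) := by
  letI : MeasurableSpace (v.adicCompletion (Fp L)) := borel _
  haveI : BorelSpace (v.adicCompletion (Fp L)) := ⟨rfl⟩
  -- (1) the Gram matrices: `T₀ = gram e T_V (a₀)` is diagonal, `T₀′ = −T₀`; (2) a mover of `ℓ_Δ` onto `ℓ_Y`; (3) `(Λᶜ_w)⁻¹ = (Λ_w)⁻¹ ∘ σ_w`; (4) ★ (C4b)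
  have hT₀t := gram_TW_eq_diagonal L e dV hdV a₀
  have hTT₀' : gram (Fp L) e (realDiagonal L dV hdV) (TW (Fp L) (-a₀)) = ((-1 : (Fp L)ˣ) : Fp L) • gram (Fp L) e (realDiagonal L dV hdV) (TW (Fp L) a₀) := by
    rw [gram_TW_eq_smul L e dV hdV a₀ (-a₀), neg_mul, mul_inv_cancel]
  have hT₀d : IsUnit (gram (Fp L) e (realDiagonal L dV hdV) (TW (Fp L) a₀)).det :=
    isUnit_det_gram (Fp L) e (isUnit_det_realDiagonal L dV hdV hdV0) (isUnit_det_TW (Fp L) a₀)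
  have hTv : IsUnit (localGram (Fp L) (2 + 2) (gramD (Fp L) 2 (gram (Fp L) e (realDiagonal L dV hdV) (TW (Fp L) a₀))) v).det :=
    UnitaryGroup.isUnit_det_map (algebraMap (Fp L) (v.adicCompletion (Fp L))) (isUnit_det_gramD (Fp L) 2 hT₀d)
  have hδ₀ := map_transportSp_deltaDiag_deltaLagrangian (Fp L) v 2 (T₀ := gram (Fp L) e (realDiagonal L dV hdV) (TW (Fp L) a₀))
    hT₀d hTv (SymplecticMatrix.mapHom (algebraMap (Fp L) (v.adicCompletion (Fp L))) (deltaD L))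
    (by rw [SymplecticMatrix.coe_mapHom]; change (Matrix.reindex _ _ (deltaDiagMatrix (Fp L) (Fin 2))).map _ = _
        rw [Matrix.reindex_apply, Matrix.reindex_apply, ← Matrix.submatrix_map, deltaDiagMatrix_map])
  obtain ⟨m₀, hm₀'⟩ := MpPsi.proj_surjective _ (existsImplementer_localSchrodinger (Fp L) (2 + 2)
    (gramD (Fp L) 2 (gram (Fp L) e (realDiagonal L dV hdV) (TW (Fp L) a₀))) (isUnit_det_gramD (Fp L) 2 hT₀d) v)
    (transportSp (localGram (Fp L) (2 + 2) (gramD (Fp L) 2 (gram (Fp L) e (realDiagonal L dV hdV) (TW (Fp L) a₀))) v) hTv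
      (SymplecticMatrix.mapHom (algebraMap (Fp L) (v.adicCompletion (Fp L))) (deltaD L)))
  have hm₀ : (deltaLagrangian (Fp L) v 2).map (toLin (Fp L) v (MpPsi.proj _ m₀)) = lagrangianY (Fp L) (2 + 2) v := by rw [hm₀']; exact hδ₀
  have hχχ' : ∀ w : PlacesOver L v,
      ((toHeckeCharacter L (IdeleClassGroup.galConj (IsCMField.complexConj L) lam)).localComponent w.1)⁻¹ =
        ((toHeckeCharacter L lam).localComponent w.1)⁻¹.comp
          (Units.map (galAdicCompletionMap (L := L) (IsCMField.complexConj L) (hns w) : w.1.adicCompletion L →* w.1.adicCompletion L)) :=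
    fun w => HeckeCharacter.localComponent_toHeckeCharacter_galConj_inv_eq_comp_of_smul_eq (IsCMField.complexConj L) lam (hns w)
  obtain ⟨E₀, hE₀⟩ := exists_coinv_equiv_galConj_similitude_models L v Measure.addHaar (isUnit_det_TW (Fp L) (-a₀)) (JW_eq (Fp L) L (-a₀))
    (JW_apply_ne_zero (Fp L) L (-a₀)) _ hT₀t (isSymm_gram (Fp L) e (realDiagonal_isSymm L dV hdV) (isSymm_TW (Fp L) a₀)) hT₀d hTd
    (isSymm_gram (Fp L) e (realDiagonal_isSymm L dV hdV) (isSymm_TW (Fp L) (-a₀)))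
    (isUnit_det_gram (Fp L) e (isUnit_det_realDiagonal L dV hdV hdV0) (isUnit_det_TW (Fp L) (-a₀))) hTT₀'
    (isSymm_gram (Fp L) e (realDiagonal_isSymm L dV hdV) (isSymm_TW (Fp L) a))
    (isUnit_det_gram (Fp L) e (isUnit_det_realDiagonal L dV hdV hdV0) (isUnit_det_TW (Fp L) a)) ha
    (reindex_kronecker_eq_gram_map (Fp L) L e (realDiagonal_map L dV hdV).symm (JW_eq (Fp L) L a₀))
    (reindex_kronecker_eq_gram_map (Fp L) L e (realDiagonal_map L dV hdV).symm (JW_eq (Fp L) L (-a₀)))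
    (reindex_kronecker_eq_gram_map (Fp L) L e (realDiagonal_map L dV hdV).symm (JW_eq (Fp L) L a)) hns
    (toHeckeCharacter L lam) (toHeckeCharacter L (IdeleClassGroup.galConj (IsCMField.complexConj L) lam))
    ((isOscillatorChar_toHeckeCharacter_iff _).mpr hlam) ((isOscillatorChar_toHeckeCharacter_iff _).mpr hlam.galConj) hχχ' m₀ hm₀
    (localCharOfCenter (Fp L) L (IsCMField.complexConj L) (JW (Fp L) L (-a₀)) (JW_apply_ne_zero (Fp L) L (-a₀)) χ v)
  -- (7) `k ⊗ 1` under the two scale retypings (★ `scaleInl_localLineInl`)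
  have hk' : ∀ k : localPi L (IsCMField.complexConj L) 2 (Matrix.diagonal dV) v, localLineInl L (IsCMField.complexConj L) 2 e (Matrix.diagonal dV) (JW (Fp L) L (-a₀)) v k =
      scaleInl (Fp L) L (IsCMField.complexConj L) 2 (gram (Fp L) e (realDiagonal L dV hdV) (TW (Fp L) a₀))
        (gram (Fp L) e (realDiagonal L dV hdV) (TW (Fp L) (-a₀))) (-1) hTT₀'
        (reindex_kronecker_eq_gram_map (Fp L) L e (realDiagonal_map L dV hdV).symm (JW_eq (Fp L) L a₀))
        (reindex_kronecker_eq_gram_map (Fp L) L e (realDiagonal_map L dV hdV).symm (JW_eq (Fp L) L (-a₀))) v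
        (localLineInl L (IsCMField.complexConj L) 2 e (Matrix.diagonal dV) (JW (Fp L) L a₀) v k) :=
    fun k => (scaleInl_localLineInl L e dV (-1) hTT₀' a₀ (-a₀) _ _ v k).symm
  have hk'' : ∀ k : localPi L (IsCMField.complexConj L) 2 (Matrix.diagonal dV) v, scaleInl (Fp L) L (IsCMField.complexConj L) 2 (gram (Fp L) e (realDiagonal L dV hdV) (TW (Fp L) a₀))
        (gram (Fp L) e (realDiagonal L dV hdV) (TW (Fp L) a)) (Units.mk0 _ hTd)⁻¹ ha
        (reindex_kronecker_eq_gram_map (Fp L) L e (realDiagonal_map L dV hdV).symm (JW_eq (Fp L) L a₀))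
        (reindex_kronecker_eq_gram_map (Fp L) L e (realDiagonal_map L dV hdV).symm (JW_eq (Fp L) L a)) v
        (localLineInl L (IsCMField.complexConj L) 2 e (Matrix.diagonal dV) (JW (Fp L) L a₀) v k) =
      localLineInl L (IsCMField.complexConj L) 2 e (Matrix.diagonal dV) (JW (Fp L) L a) v k :=
    fun k => scaleInl_localLineInl L e dV _ ha a₀ a _ _ v k
  -- the two packages' Weil representations ARE `toRep ∘ localSplittingCMWith … addHaar` (hypotheses `h𝓣′`, `h𝓣`)
  have hρ' : ((MpPsi.toRep (localSchrodinger (Fp L) 2 (gram (Fp L) e (realDiagonal L dV hdV) (TW (Fp L) (-a₀))) v)).comp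
      (localSplittingCMWith L 2 (isSymm_gram (Fp L) e (realDiagonal_isSymm L dV hdV) (isSymm_TW (Fp L) (-a₀)))
        (isUnit_det_gram (Fp L) e (isUnit_det_realDiagonal L dV hdV hdV0) (isUnit_det_TW (Fp L) (-a₀)))
        (reindex_kronecker_eq_gram_map (Fp L) L e (realDiagonal_map L dV hdV).symm (JW_eq (Fp L) L (-a₀)))
        (toHeckeCharacter L (IdeleClassGroup.galConj (IsCMField.complexConj L) lam))
        ((isOscillatorChar_toHeckeCharacter_iff _).mpr hlam.galConj) v Measure.addHaar)) = 𝓣'.omegaLoc v := by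
    show _ = (MpPsi.toRep _).comp (𝓣'.s v); rw [h𝓣']; rfl
  have hρ : ((MpPsi.toRep (localSchrodinger (Fp L) 2 (gram (Fp L) e (realDiagonal L dV hdV) (TW (Fp L) a)) v)).comp
      (localSplittingCMWith L 2 (isSymm_gram (Fp L) e (realDiagonal_isSymm L dV hdV) (isSymm_TW (Fp L) a))
        (isUnit_det_gram (Fp L) e (isUnit_det_realDiagonal L dV hdV hdV0) (isUnit_det_TW (Fp L) a))
        (reindex_kronecker_eq_gram_map (Fp L) L e (realDiagonal_map L dV hdV).symm (JW_eq (Fp L) L a))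
        (toHeckeCharacter L lam) ((isOscillatorChar_toHeckeCharacter_iff _).mpr hlam) v Measure.addHaar)) = 𝓣.omegaLoc v := by
    show _ = (MpPsi.toRep _).comp (𝓣.s v); rw [h𝓣]; rfl
  obtain ⟨e₁, he₁⟩ := exists_equiv_of_eq _ _ hρ' (localCenter L (IsCMField.complexConj L) 2 (Matrix.reindex e e (Matrix.diagonal dV ⊗ₖ JW (Fp L) L (-a₀)))
      (JW (Fp L) L (-a₀)) (JW_apply_ne_zero (Fp L) L (-a₀)) v) ((localCharOfCenter (Fp L) L (IsCMField.complexConj L) (JW (Fp L) L (-a₀)) (JW_apply_ne_zero (Fp L) L (-a₀)) χ v).comp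
      (localPiGalConj L (IsCMField.complexConj L) 1 v (JW_eq (Fp L) L (-a₀))))
    (commute_comp_localCenter' (JW_apply_ne_zero (Fp L) L (-a₀)) (𝓣'.omegaLoc v)) (commute_comp_localCenter' (JW_apply_ne_zero (Fp L) L (-a₀)) ((MpPsi.toRep (localSchrodinger (Fp L) 2 (gram (Fp L) e (realDiagonal L dV hdV) (TW (Fp L) (-a₀))) v)).comp
      (localSplittingCMWith L 2 (isSymm_gram (Fp L) e (realDiagonal_isSymm L dV hdV) (isSymm_TW (Fp L) (-a₀)))
        (isUnit_det_gram (Fp L) e (isUnit_det_realDiagonal L dV hdV hdV0) (isUnit_det_TW (Fp L) (-a₀)))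
        (reindex_kronecker_eq_gram_map (Fp L) L e (realDiagonal_map L dV hdV).symm (JW_eq (Fp L) L (-a₀)))
        (toHeckeCharacter L (IdeleClassGroup.galConj (IsCMField.complexConj L) lam))
        ((isOscillatorChar_toHeckeCharacter_iff _).mpr hlam.galConj) v Measure.addHaar)))
  obtain ⟨e₂, he₂⟩ := exists_equiv_of_eq _ _ hρ (localCenter L (IsCMField.complexConj L) 2 (Matrix.reindex e e (Matrix.diagonal dV ⊗ₖ JW (Fp L) L a))
      (JW (Fp L) L (-a₀)) (JW_apply_ne_zero (Fp L) L (-a₀)) v) (localCharOfCenter (Fp L) L (IsCMField.complexConj L) (JW (Fp L) L (-a₀)) (JW_apply_ne_zero (Fp L) L (-a₀)) χ v)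
    (commute_comp_localCenter' (JW_apply_ne_zero (Fp L) L (-a₀)) (𝓣.omegaLoc v)) (commute_comp_localCenter' (JW_apply_ne_zero (Fp L) L (-a₀)) ((MpPsi.toRep (localSchrodinger (Fp L) 2 (gram (Fp L) e (realDiagonal L dV hdV) (TW (Fp L) a)) v)).comp
      (localSplittingCMWith L 2 (isSymm_gram (Fp L) e (realDiagonal_isSymm L dV hdV) (isSymm_TW (Fp L) a))
        (isUnit_det_gram (Fp L) e (isUnit_det_realDiagonal L dV hdV hdV0) (isUnit_det_TW (Fp L) a))
        (reindex_kronecker_eq_gram_map (Fp L) L e (realDiagonal_map L dV hdV).symm (JW_eq (Fp L) L a))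
        (toHeckeCharacter L lam) ((isOscillatorChar_toHeckeCharacter_iff _).mpr hlam) v Measure.addHaar)))
  -- on the `Λ` side, retype the centre from the line `−a₀` to the line `a` (`scaleInl₁`)
  obtain ⟨e₃, he₃⟩ := exists_equiv_of_comp_centre (𝓣.omegaLoc v) (localCenter L (IsCMField.complexConj L) 2 (Matrix.reindex e e (Matrix.diagonal dV ⊗ₖ JW (Fp L) L a))
      (JW (Fp L) L a) (JW_apply_ne_zero (Fp L) L a) v) (localCenter L (IsCMField.complexConj L) 2 (Matrix.reindex e e (Matrix.diagonal dV ⊗ₖ JW (Fp L) L a))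
      (JW (Fp L) L (-a₀)) (JW_apply_ne_zero (Fp L) L (-a₀)) v)
    (scaleInl (Fp L) L (IsCMField.complexConj L) 1 (TW (Fp L) (-a₀)) (TW (Fp L) a) (a * (-a₀)⁻¹) (TW_eq_smul_TW (Fp L) (-a₀) a)
      (JW_eq (Fp L) L (-a₀)) (JW_eq (Fp L) L a) v)
    (scaleInl_one_surjective (Fp L) L (IsCMField.complexConj L) (-a₀) a v)
    (fun z => (localCenter_scaleInl_one (Fp L) L (IsCMField.complexConj L) (-a₀) a v _ z).symm)
    (localCharOfCenter (Fp L) L (IsCMField.complexConj L) (JW (Fp L) L a) (JW_apply_ne_zero (Fp L) L a) χ v) (localCharOfCenter (Fp L) L (IsCMField.complexConj L) (JW (Fp L) L (-a₀)) (JW_apply_ne_zero (Fp L) L (-a₀)) χ v)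
    (fun z => (localCharOfCenter_scaleInl_one (Fp L) L (IsCMField.complexConj L) (-a₀) a v χ z).symm)
    (commute_comp_localCenter' (JW_apply_ne_zero (Fp L) L a) (𝓣.omegaLoc v)) (commute_comp_localCenter' (JW_apply_ne_zero (Fp L) L (-a₀)) (𝓣.omegaLoc v))
  exact exists_conj_twisted_intertwiner
    (fun k => rep ((localCharOfCenter (Fp L) L (IsCMField.complexConj L) (JW (Fp L) L (-a₀)) (JW_apply_ne_zero (Fp L) L (-a₀)) χ v).comp
      (localPiGalConj L (IsCMField.complexConj L) 1 v (JW_eq (Fp L) L (-a₀)))) ((MpPsi.toRep (localSchrodinger (Fp L) 2 (gram (Fp L) e (realDiagonal L dV hdV) (TW (Fp L) (-a₀))) v)).comp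
      (localSplittingCMWith L 2 (isSymm_gram (Fp L) e (realDiagonal_isSymm L dV hdV) (isSymm_TW (Fp L) (-a₀)))
        (isUnit_det_gram (Fp L) e (isUnit_det_realDiagonal L dV hdV hdV0) (isUnit_det_TW (Fp L) (-a₀)))
        (reindex_kronecker_eq_gram_map (Fp L) L e (realDiagonal_map L dV hdV).symm (JW_eq (Fp L) L (-a₀)))
        (toHeckeCharacter L (IdeleClassGroup.galConj (IsCMField.complexConj L) lam))
        ((isOscillatorChar_toHeckeCharacter_iff _).mpr hlam.galConj) v Measure.addHaar)) (commute_comp_localCenter' (JW_apply_ne_zero (Fp L) L (-a₀)) ((MpPsi.toRep (localSchrodinger (Fp L) 2 (gram (Fp L) e (realDiagonal L dV hdV) (TW (Fp L) (-a₀))) v)).comp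
      (localSplittingCMWith L 2 (isSymm_gram (Fp L) e (realDiagonal_isSymm L dV hdV) (isSymm_TW (Fp L) (-a₀)))
        (isUnit_det_gram (Fp L) e (isUnit_det_realDiagonal L dV hdV hdV0) (isUnit_det_TW (Fp L) (-a₀)))
        (reindex_kronecker_eq_gram_map (Fp L) L e (realDiagonal_map L dV hdV).symm (JW_eq (Fp L) L (-a₀)))
        (toHeckeCharacter L (IdeleClassGroup.galConj (IsCMField.complexConj L) lam))
        ((isOscillatorChar_toHeckeCharacter_iff _).mpr hlam.galConj) v Measure.addHaar))) (localLineInl L (IsCMField.complexConj L) 2 e (Matrix.diagonal dV) (JW (Fp L) L (-a₀)) v k))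
    (fun k => rep (localCharOfCenter (Fp L) L (IsCMField.complexConj L) (JW (Fp L) L (-a₀)) (JW_apply_ne_zero (Fp L) L (-a₀)) χ v) ((MpPsi.toRep (localSchrodinger (Fp L) 2 (gram (Fp L) e (realDiagonal L dV hdV) (TW (Fp L) a)) v)).comp
      (localSplittingCMWith L 2 (isSymm_gram (Fp L) e (realDiagonal_isSymm L dV hdV) (isSymm_TW (Fp L) a))
        (isUnit_det_gram (Fp L) e (isUnit_det_realDiagonal L dV hdV hdV0) (isUnit_det_TW (Fp L) a))
        (reindex_kronecker_eq_gram_map (Fp L) L e (realDiagonal_map L dV hdV).symm (JW_eq (Fp L) L a))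
        (toHeckeCharacter L lam) ((isOscillatorChar_toHeckeCharacter_iff _).mpr hlam) v Measure.addHaar)) (commute_comp_localCenter' (JW_apply_ne_zero (Fp L) L (-a₀)) ((MpPsi.toRep (localSchrodinger (Fp L) 2 (gram (Fp L) e (realDiagonal L dV hdV) (TW (Fp L) a)) v)).comp
      (localSplittingCMWith L 2 (isSymm_gram (Fp L) e (realDiagonal_isSymm L dV hdV) (isSymm_TW (Fp L) a))
        (isUnit_det_gram (Fp L) e (isUnit_det_realDiagonal L dV hdV hdV0) (isUnit_det_TW (Fp L) a))
        (reindex_kronecker_eq_gram_map (Fp L) L e (realDiagonal_map L dV hdV).symm (JW_eq (Fp L) L a))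
        (toHeckeCharacter L lam) ((isOscillatorChar_toHeckeCharacter_iff _).mpr hlam) v Measure.addHaar))) (localLineInl L (IsCMField.complexConj L) 2 e (Matrix.diagonal dV) (JW (Fp L) L a) v k))
    (fun k => rep ((localCharOfCenter (Fp L) L (IsCMField.complexConj L) (JW (Fp L) L (-a₀)) (JW_apply_ne_zero (Fp L) L (-a₀)) χ v).comp
      (localPiGalConj L (IsCMField.complexConj L) 1 v (JW_eq (Fp L) L (-a₀)))) (𝓣'.omegaLoc v) (commute_comp_localCenter' (JW_apply_ne_zero (Fp L) L (-a₀)) (𝓣'.omegaLoc v)) (localLineInl L (IsCMField.complexConj L) 2 e (Matrix.diagonal dV) (JW (Fp L) L (-a₀)) v k))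
    (fun k => rep (localCharOfCenter (Fp L) L (IsCMField.complexConj L) (JW (Fp L) L a) (JW_apply_ne_zero (Fp L) L a) χ v) (𝓣.omegaLoc v) (commute_comp_localCenter' (JW_apply_ne_zero (Fp L) L a) (𝓣.omegaLoc v)) (localLineInl L (IsCMField.complexConj L) 2 e (Matrix.diagonal dV) (JW (Fp L) L a) v k))
    (fun k => (((localCharOfCenter (Fp L) L (IsCMField.complexConj L) (JW (Fp L) L (-a₀)) (JW_apply_ne_zero (Fp L) L (-a₀)) χ v)
        (localUnitScalar L (IsCMField.complexConj L) (JW (Fp L) L (-a₀)) v _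
          (inv_det_mul_conjLocal_inv_det L (IsCMField.complexConj L)
            (reindex_kronecker_eq_gram_map (Fp L) L e (realDiagonal_map L dV hdV).symm (JW_eq (Fp L) L a₀)) v
            (complexConj_imagUnit L) (imagUnit_ne_zero L) hTd (localLineInl L (IsCMField.complexConj L) 2 e (Matrix.diagonal dV) (JW (Fp L) L a₀) v k))) : ℂˣ) : ℂ))
    ⟨E₀, fun k x =>
      (congrArg (fun g => E₀ (rep ((localCharOfCenter (Fp L) L (IsCMField.complexConj L) (JW (Fp L) L (-a₀)) (JW_apply_ne_zero (Fp L) L (-a₀)) χ v).comp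
      (localPiGalConj L (IsCMField.complexConj L) 1 v (JW_eq (Fp L) L (-a₀)))) ((MpPsi.toRep (localSchrodinger (Fp L) 2 (gram (Fp L) e (realDiagonal L dV hdV) (TW (Fp L) (-a₀))) v)).comp
      (localSplittingCMWith L 2 (isSymm_gram (Fp L) e (realDiagonal_isSymm L dV hdV) (isSymm_TW (Fp L) (-a₀)))
        (isUnit_det_gram (Fp L) e (isUnit_det_realDiagonal L dV hdV hdV0) (isUnit_det_TW (Fp L) (-a₀)))
        (reindex_kronecker_eq_gram_map (Fp L) L e (realDiagonal_map L dV hdV).symm (JW_eq (Fp L) L (-a₀)))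
        (toHeckeCharacter L (IdeleClassGroup.galConj (IsCMField.complexConj L) lam))
        ((isOscillatorChar_toHeckeCharacter_iff _).mpr hlam.galConj) v Measure.addHaar))
          (commute_comp_localCenter' (JW_apply_ne_zero (Fp L) L (-a₀)) ((MpPsi.toRep (localSchrodinger (Fp L) 2 (gram (Fp L) e (realDiagonal L dV hdV) (TW (Fp L) (-a₀))) v)).comp
      (localSplittingCMWith L 2 (isSymm_gram (Fp L) e (realDiagonal_isSymm L dV hdV) (isSymm_TW (Fp L) (-a₀)))
        (isUnit_det_gram (Fp L) e (isUnit_det_realDiagonal L dV hdV hdV0) (isUnit_det_TW (Fp L) (-a₀)))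
        (reindex_kronecker_eq_gram_map (Fp L) L e (realDiagonal_map L dV hdV).symm (JW_eq (Fp L) L (-a₀)))
        (toHeckeCharacter L (IdeleClassGroup.galConj (IsCMField.complexConj L) lam))
        ((isOscillatorChar_toHeckeCharacter_iff _).mpr hlam.galConj) v Measure.addHaar))) g x)) (hk' k)).trans
        ((hE₀ (localLineInl L (IsCMField.complexConj L) 2 e (Matrix.diagonal dV) (JW (Fp L) L a₀) v k) x).trans
          (congrArg (fun g => (((localCharOfCenter (Fp L) L (IsCMField.complexConj L) (JW (Fp L) L (-a₀)) (JW_apply_ne_zero (Fp L) L (-a₀)) χ v)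
        (localUnitScalar L (IsCMField.complexConj L) (JW (Fp L) L (-a₀)) v _
          (inv_det_mul_conjLocal_inv_det L (IsCMField.complexConj L)
            (reindex_kronecker_eq_gram_map (Fp L) L e (realDiagonal_map L dV hdV).symm (JW_eq (Fp L) L a₀)) v
            (complexConj_imagUnit L) (imagUnit_ne_zero L) hTd (localLineInl L (IsCMField.complexConj L) 2 e (Matrix.diagonal dV) (JW (Fp L) L a₀) v k))) : ℂˣ) : ℂ) •
              rep (localCharOfCenter (Fp L) L (IsCMField.complexConj L) (JW (Fp L) L (-a₀)) (JW_apply_ne_zero (Fp L) L (-a₀)) χ v) ((MpPsi.toRep (localSchrodinger (Fp L) 2 (gram (Fp L) e (realDiagonal L dV hdV) (TW (Fp L) a)) v)).comp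
      (localSplittingCMWith L 2 (isSymm_gram (Fp L) e (realDiagonal_isSymm L dV hdV) (isSymm_TW (Fp L) a))
        (isUnit_det_gram (Fp L) e (isUnit_det_realDiagonal L dV hdV hdV0) (isUnit_det_TW (Fp L) a))
        (reindex_kronecker_eq_gram_map (Fp L) L e (realDiagonal_map L dV hdV).symm (JW_eq (Fp L) L a))
        (toHeckeCharacter L lam) ((isOscillatorChar_toHeckeCharacter_iff _).mpr hlam) v Measure.addHaar)) (commute_comp_localCenter' (JW_apply_ne_zero (Fp L) L (-a₀)) ((MpPsi.toRep (localSchrodinger (Fp L) 2 (gram (Fp L) e (realDiagonal L dV hdV) (TW (Fp L) a)) v)).comp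
      (localSplittingCMWith L 2 (isSymm_gram (Fp L) e (realDiagonal_isSymm L dV hdV) (isSymm_TW (Fp L) a))
        (isUnit_det_gram (Fp L) e (isUnit_det_realDiagonal L dV hdV hdV0) (isUnit_det_TW (Fp L) a))
        (reindex_kronecker_eq_gram_map (Fp L) L e (realDiagonal_map L dV hdV).symm (JW_eq (Fp L) L a))
        (toHeckeCharacter L lam) ((isOscillatorChar_toHeckeCharacter_iff _).mpr hlam) v Measure.addHaar))) g (E₀ x)) (hk'' k)))⟩
    ⟨e₁, fun k x => he₁ _ x⟩
    (exists_equiv_trans _ _ _ ⟨e₂, fun k y => he₂ _ y⟩ ⟨e₃, fun k y => he₃ _ y⟩)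

end CM

end Summit.HodgeConjecture.HodgeConjecture.Cruxes.HLiu418.F0P5LemD14IfGaloisSimilitudeTheta

end
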